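import Summits.Ventures.Crystal3D.Theorems.StickyWulffConstantCoaxialWallLawPayerFamilyEndsGen
import Summits.Ventures.Crystal3D.Theorems.StickyWulffConstantCoaxialWallLawEndUniqueGen
import HarnessLib

/-!
# End accounting at every version (v1/v2): the pooled END PAIRS of several word families, typed export

HONEST FRAMING. Venture `Summits/Ventures/Crystal3D` (cell `crystal3d-full`), helper `--supports` the crux
`CoaxialWallLaw` of `route-Ventures-StickyWulffConstant` (REGISTERED line `WallLedgerF`).  Rung credit; F-C1 not
moved; inputs `KissingGap δ`, `KissingClassification δ` by name.  cf-p1 g28 (xxxviii″): the VERSION-PARAMETRIC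
re-landing of `word_endPairs_multiExcl_invRoot_nm` (`…PayerEndPairsMultiRootNm`; it subsumes `…MultiNm` with
`P r := P` and the twin cells' `P := True`): several roots `r ∈ RT` over one base frame `F []`, each with its own
state invariant `P r` preserved by the LEGAL moves of version `ver`; the families' typed end pairs
(`word_family_endPairs_gen`) are pairwise DISJOINT across roots by LEMMA X in its shape form
(`word_target_ne_of_roots_ne_shape`, `…EndUniqueGen` — valid for every move kind, NARROW included), so they pool
into one set `T` with `Σ_r #sources_r ≤ #T + #RT·rim`, every pair exported with its root, a well-formed chain, the
invariant, the predecessor clause `q − d ∈ X` and **`IsEndMove X ver (F κ) d q b`**.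

* `shape_of_isEndMove` — the target of an end move is `q + d` or `q − M_m d` for a unit menu normal `m` crossing `d`.
* **`word_endPairs_multi_gen`**.
WHAT THIS IS NOT: the twin / translation cells are the next files; F-C1 not moved.
-/
noncomputable section

namespace Summit.Ventures.Crystal3D.Theorems

open Summit.Ventures.Crystal3D Finset
open Literature.MathematicalPhysics.StatisticalMechanics (fccStacking)
open scoped InnerProductSpace

/-- The SHAPE of an end move: straight `b = q + d`, or cross `b = q − M_m d` along a unit menu normal `m` of the
frame crossing `d` upward. -/
theorem shape_of_isEndMove {X : Finset (EuclideanSpace ℝ (Fin 3))} {ver : WordVersion}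
    {G : EuclideanSpace ℝ (Fin 3) ≃ₗᵢ[ℝ] EuclideanSpace ℝ (Fin 3)} {d q b : EuclideanSpace ℝ (Fin 3)}
    (h : IsEndMove X ver G d q b) :
    b = q + d ∨ ∃ m : EuclideanSpace ℝ (Fin 3), ‖m‖ = 1 ∧
      (∀ w ∈ fccSlots, ⟪G w, m⟫_ℝ = 0 ∨ ⟪G w, m⟫_ℝ = Real.sqrt (2 / 3) ∨ ⟪G w, m⟫_ℝ = -Real.sqrt (2 / 3)) ∧
      ⟪d, m⟫_ℝ = Real.sqrt (2 / 3) ∧ b = q - (d - (2 * ⟪d, m⟫_ℝ) • m) := by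
  rcases h with ⟨-, hb, -⟩ | ⟨m, htd, hdm, hb, -⟩
  · exact Or.inl hb
  · exact Or.inr ⟨m, htd.1.1, htd.1.2, hdm, hb⟩

section MultiRoot

variable {X : Finset (EuclideanSpace ℝ (Fin 3))}
  {F : List (EuclideanSpace ℝ (Fin 3)) → (EuclideanSpace ℝ (Fin 3) ≃ₗᵢ[ℝ] EuclideanSpace ℝ (Fin 3))}
  {u : EuclideanSpace ℝ (Fin 3) → List (EuclideanSpace ℝ (Fin 3)) → EuclideanSpace ℝ (Fin 3)}
  {WF : EuclideanSpace ℝ (Fin 3) → List (EuclideanSpace ℝ (Fin 3)) → Prop}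
  {next : List (EuclideanSpace ℝ (Fin 3)) → EuclideanSpace ℝ (Fin 3) → List (EuclideanSpace ℝ (Fin 3))}
  {P₁ P' P₂ : Finset (EuclideanSpace ℝ (Fin 3))} {t₁ t₂ : EuclideanSpace ℝ (Fin 3)} {R₀ h ρ : ℝ}

open scoped Classical in
/-- **The multi-root end pairs at version `ver`, typed export.**  See the module docstring. -/
theorem word_endPairs_multi_gen (ver : WordVersion) {δ : ℝ} (hg : KissingGap δ) (hc : KissingClassification δ)
    (hX : ∀ p ∈ X, ∀ q ∈ X, p ≠ q → 1 ≤ dist p q)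
    (hFc : ∀ μ κ, F (μ :: κ) = ((ℝ ∙ μ)ᗮ.reflection).trans (F κ))
    (RT : Finset (EuclideanSpace ℝ (Fin 3))) (hRT : ∀ r ∈ RT, r ∈ fccSlots)
    (hu0 : ∀ r ∈ RT, u r [] = r) (huc : ∀ r ∈ RT, ∀ μ κ, u r (μ :: κ) = -u r κ)
    (hWF0 : ∀ r ∈ RT, WF r [])
    (hWFc : ∀ r ∈ RT, ∀ μ κ, WF r (μ :: κ) ↔ (WF r κ ∧ ‖μ‖ = 1 ∧
      (∀ w ∈ fccSlots, ⟪w, μ⟫_ℝ = 0 ∨ ⟪w, μ⟫_ℝ = Real.sqrt (2 / 3) ∨ ⟪w, μ⟫_ℝ = -Real.sqrt (2 / 3)) ∧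
      ⟪u r κ, μ⟫_ℝ = Real.sqrt (2 / 3) ∧ ∀ μ' κ', κ = μ' :: κ' → μ' ≠ -μ))
    (hnext_pop : ∀ μ κ' (m : EuclideanSpace ℝ (Fin 3)), (F (μ :: κ')).symm m = -μ → next (μ :: κ') m = κ')
    (hnext_push : ∀ κ (m : EuclideanSpace ℝ (Fin 3)), (∀ μ κ', κ = μ :: κ' → (F κ).symm m ≠ -μ) →
      next κ m = (F κ).symm m :: κ)
    -- the top grain's frame and the root-indexed state invariants (preserved by LEGAL moves)
    (G₂ : EuclideanSpace ℝ (Fin 3) ≃ₗᵢ[ℝ] EuclideanSpace ℝ (Fin 3))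
    {P : EuclideanSpace ℝ (Fin 3) → EuclideanSpace ℝ (Fin 3) × List (EuclideanSpace ℝ (Fin 3)) → Prop}
    (hPstraight : ∀ r ∈ RT, ∀ (b : EuclideanSpace ℝ (Fin 3)) (κ : List (EuclideanSpace ℝ (Fin 3))), WF r κ →
      (IsFull X (F κ) b ∨ (∃ m, IsTwinReading X (F κ) m b ∧ ⟪F κ (u r κ), m⟫_ℝ = 0) ∨
        (ver = WordVersion.v2 ∧ IsNarrow X (F κ) (F κ (u r κ)) b)) →
      P r (b, κ) → P r (b + F κ (u r κ), κ))
    (hPcross : ∀ r ∈ RT, ∀ (b : EuclideanSpace ℝ (Fin 3)) (κ : List (EuclideanSpace ℝ (Fin 3)))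
      (m : EuclideanSpace ℝ (Fin 3)), WF r κ → WF r (next κ m) → IsTwinReading X (F κ) m b →
      ⟪F κ (u r κ), m⟫_ℝ = Real.sqrt (2 / 3) → P r (b, κ) → P r (b + F (next κ m) (u r (next κ m)), next κ m))
    (hPexcl0 : ∀ r ∈ RT, ∀ (b : EuclideanSpace ℝ (Fin 3)) (κ : List (EuclideanSpace ℝ (Fin 3))), WF r κ → P r (b, κ) →
      b ∈ P₂ → (∀ w ∈ fccSlots, b + G₂ w ∈ X) →
      (∃ a ∈ fccSlots, ∃ a' ∈ fccSlots, ∃ a'' ∈ fccSlots,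
        ⟪a, a'⟫_ℝ = 1 / 2 ∧ ⟪a, a''⟫_ℝ = 1 / 2 ∧ ⟪a', a''⟫_ℝ = 1 / 2 ∧
        b + F κ a ∈ X ∧ b + F κ a' ∈ X ∧ b + F κ a'' ∈ X) → False)
    (hup : ∀ r ∈ RT, 0 < (F [] r) 2)
    -- the cell
    (hR₀ : 3 ≤ R₀) (hρ : R₀ ≤ ρ)
    (hcell : ∀ p ∈ X, -(2 * R₀) ≤ p 2 ∧ p 2 ≤ h + 2 * R₀ ∧ p 0 ^ 2 + p 1 ^ 2 ≤ ρ ^ 2)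
    (hP₁X : P₁ ⊆ X) (hP₂X : P₂ ⊆ X)
    (hP₁ : ∀ p, p ∈ P₁ ↔ (p ∈ (fun q => F [] q + t₁) '' fccStacking 1 (Real.sqrt (2 / 3)) ∧
      -(2 * R₀) ≤ p 2 ∧ p 2 ≤ -R₀ ∧ p 0 ^ 2 + p 1 ^ 2 ≤ ρ ^ 2))
    (hP' : ∀ p, p ∈ P' ↔ (p ∈ (fun q => F [] q + t₁) '' fccStacking 1 (Real.sqrt (2 / 3)) ∧
      -(2 * R₀) + 1 ≤ p 2 ∧ p 2 ≤ -R₀ - 1 ∧ p 0 ^ 2 + p 1 ^ 2 ≤ (ρ - 1) ^ 2))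
    (hP'full : ∀ p ∈ P', ∀ w ∈ fccSlots, p + F [] w ∈ X)
    (hPsrc : ∀ r ∈ RT, ∀ p ∈ P', P r (p + F [] r, []))
    (hP₂ : ∀ p, p ∈ P₂ ↔ (p ∈ (fun q => G₂ q + t₂) '' fccStacking 1 (Real.sqrt (2 / 3)) ∧
      h + R₀ ≤ p 2 ∧ p 2 ≤ h + 2 * R₀ ∧ p 0 ^ 2 + p 1 ^ 2 ≤ ρ ^ 2)) :
    ∃ T : Finset (EuclideanSpace ℝ (Fin 3) × EuclideanSpace ℝ (Fin 3)),
      ∑ r ∈ RT, (P'.filter fun p => (∀ w ∈ fccSlots, p + F [] w ∈ X) ∧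
          -R₀ - 1 < (p + F [] r) 2 ∧ (p + F [] r) 2 < h + R₀ + 1).card ≤
        T.card + RT.card *
          (220 * (X.filter fun s => h + R₀ + 1 ≤ s 2 ∧ s 2 ≤ h + R₀ + 1 + 1 ∧ (ρ - 2) ^ 2 < s 0 ^ 2 + s 1 ^ 2).card +
           220 * (X.filter fun s => -R₀ - 1 - 1 ≤ s 2 ∧ s 2 < -R₀ - 1 ∧ (ρ - 1) ^ 2 < s 0 ^ 2 + s 1 ^ 2).card) ∧
      (∀ bq ∈ T, bq.1 ∈ X ∧ bq.2 ∈ X ∧ dist bq.1 bq.2 = 1 ∧ -R₀ - 1 ≤ bq.1 2 ∧ bq.1 2 < h + R₀ + 1) ∧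
      (∀ bq ∈ T, (X.filter fun q => dist bq.1 q = 1).card ≤ 11 ∨
        ∃ z₁ ∈ X, ∃ z₂ ∈ X, z₁ ≠ z₂ ∧ dist bq.1 z₁ = 1 ∧ dist bq.1 z₂ = 1 ∧
          (X.filter fun q => dist z₁ q = 1).card ≤ 11 ∧ (X.filter fun q => dist z₂ q = 1).card ≤ 11) ∧
      (∀ bq ∈ T, ∃ r ∈ RT, (∃ κ, WF r κ ∧ P r (bq.1, κ)) ∧
        ∃ κ, WF r κ ∧ bq.2 - F κ (u r κ) ∈ X ∧ IsEndMove X ver (F κ) (F κ (u r κ)) bq.2 bq.1) := by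
  set RIM : ℕ :=
    220 * (X.filter fun s => h + R₀ + 1 ≤ s 2 ∧ s 2 ≤ h + R₀ + 1 + 1 ∧ (ρ - 2) ^ 2 < s 0 ^ 2 + s 1 ^ 2).card +
      220 * (X.filter fun s => -R₀ - 1 - 1 ≤ s 2 ∧ s 2 < -R₀ - 1 ∧ (ρ - 1) ^ 2 < s 0 ^ 2 + s 1 ^ 2).card with hRIM
  -- the per-family end pairs, each family with its own invariant `P r`
  have hfam : ∀ r ∈ RT, ∃ T : Finset (EuclideanSpace ℝ (Fin 3) × EuclideanSpace ℝ (Fin 3)),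
      (P'.filter fun p => (∀ w ∈ fccSlots, p + F [] w ∈ X) ∧
          -R₀ - 1 < (p + F [] r) 2 ∧ (p + F [] r) 2 < h + R₀ + 1).card ≤ T.card + RIM ∧
      (∀ bq ∈ T, bq.1 ∈ X ∧ bq.2 ∈ X ∧ dist bq.1 bq.2 = 1 ∧ -R₀ - 1 ≤ bq.1 2 ∧ bq.1 2 < h + R₀ + 1) ∧
      (∀ bq ∈ T, (X.filter fun q => dist bq.1 q = 1).card ≤ 11 ∨
        ∃ z₁ ∈ X, ∃ z₂ ∈ X, z₁ ≠ z₂ ∧ dist bq.1 z₁ = 1 ∧ dist bq.1 z₂ = 1 ∧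
          (X.filter fun q => dist z₁ q = 1).card ≤ 11 ∧ (X.filter fun q => dist z₂ q = 1).card ≤ 11) ∧
      (∀ bq ∈ T, ∃ κ, WF r κ ∧ P r (bq.1, κ)) ∧
      (∀ bq ∈ T, ∃ κ, WF r κ ∧ bq.2 - F κ (u r κ) ∈ X ∧ IsEndMove X ver (F κ) (F κ (u r κ)) bq.2 bq.1) := by
    intro r hr
    have hur : ∀ κ, u r κ ∈ fccSlots := word_u_mem (hRT r hr) (hu0 r hr) (huc r hr)
    have hup' : 0 < (F [] (u r [])) 2 := by rw [hu0 r hr]; exact hup r hr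
    have hPsrc' : ∀ p ∈ P', P r (p + F [] (u r []), []) := by rw [hu0 r hr]; exact hPsrc r hr
    obtain ⟨T, hkey, hT, hpay, hinv, hwit⟩ := word_family_endPairs_gen ver (F := F) (u := u r) (WF := WF r)
      (next := next) (t₁ := t₁) (t₂ := t₂) (P := P r) hg hc hX hFc hur (huc r hr) (hWF0 r hr) (hWFc r hr)
      hnext_pop hnext_push G₂ (hPstraight r hr) (hPcross r hr) (hPexcl0 r hr) hup' hR₀ hρ hcell hP₁X hP₂X hP₁ hP'
      hP'full hPsrc' hP₂
    rw [hu0 r hr] at hkey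
    exact ⟨T, by rw [hRIM]; linarith [hkey], hT, hpay, hinv, hwit⟩
  choose! Tf hTkey hTpair hTpay hTinv hTwit using hfam
  -- pairwise disjointness across roots: LEMMA X (shape form)
  have hdisj : ∀ r ∈ RT, ∀ r' ∈ RT, r ≠ r' → Disjoint (Tf r) (Tf r') := by
    intro r hr r' hr' hrr'
    rw [Finset.disjoint_left]
    intro bq hbq hbq'
    obtain ⟨κ, hκ, -, hmove⟩ := hTwit r hr bq hbq
    obtain ⟨κ', hκ', -, hmove'⟩ := hTwit r' hr' bq hbq'
    obtain ⟨hlet, hch⟩ := word_letters_of_wf (huc r hr) (hWFc r hr) κ hκ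
    obtain ⟨hlet', hch'⟩ := word_letters_of_wf (huc r' hr') (hWFc r' hr') κ' hκ'
    have hob := word_letters_oblique_of_wf (huc r hr) (hWFc r hr) κ hκ
    have hob' := word_letters_oblique_of_wf (huc r' hr') (hWFc r' hr') κ' hκ'
    rw [hu0 r hr] at hob
    rw [hu0 r' hr'] at hob'
    have hne' : r ≠ -r' := by
      intro h
      have h1 := hup r hr
      have h2 := hup r' hr'
      rw [h, map_neg, PiLp.neg_apply] at h1
      linarith
    have hd : F κ (u r κ) = F κ (((-1 : ℝ) ^ κ.length) • r) := by rw [word_u_eq_pow (huc r hr) κ, hu0 r hr]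
    have hd' : F κ' (u r' κ') = F κ' (((-1 : ℝ) ^ κ'.length) • r') := by
      rw [word_u_eq_pow (huc r' hr') κ', hu0 r' hr']
    exact word_target_ne_of_roots_ne_shape hFc hlet hlet' hch hch' (hRT r hr) (hRT r' hr') hrr' hne' hob hob'
      (neg_one_pow_eq_or ℝ κ.length) (neg_one_pow_eq_or ℝ κ'.length) hd hd'
      (shape_of_isEndMove hmove) (shape_of_isEndMove hmove') rfl
  -- export the pooled pair set
  refine ⟨RT.biUnion Tf, ?_, ?_, ?_, ?_⟩
  · rw [card_biUnion hdisj]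
    calc ∑ r ∈ RT, (P'.filter fun p => (∀ w ∈ fccSlots, p + F [] w ∈ X) ∧
            -R₀ - 1 < (p + F [] r) 2 ∧ (p + F [] r) 2 < h + R₀ + 1).card
        ≤ ∑ r ∈ RT, ((Tf r).card + RIM) := sum_le_sum fun r hr => hTkey r hr
      _ = ∑ r ∈ RT, (Tf r).card + RT.card * RIM := by rw [sum_add_distrib, sum_const, smul_eq_mul]
      _ ≤ _ := by rw [hRIM]
  · intro bq hbq
    obtain ⟨r, hr, hbqr⟩ := mem_biUnion.1 hbq
    exact hTpair r hr bq hbqr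
  · intro bq hbq
    obtain ⟨r, hr, hbqr⟩ := mem_biUnion.1 hbq
    exact hTpay r hr bq hbqr
  · intro bq hbq
    obtain ⟨r, hr, hbqr⟩ := mem_biUnion.1 hbq
    exact ⟨r, hr, hTinv r hr bq hbqr, hTwit r hr bq hbqr⟩

end MultiRoot

end Summit.Ventures.Crystal3D.Theorems

end
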